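import Summits.QuantumFields.YangMills.Theorems.BalabanUVNodesN18KingModel
import Summits.QuantumFields.YangMills.Theorems.BalabanUVNodesN18Coherence

/-!
# BalabanUVNodes ∕ N18 — node U3's THREE BRACKETS for the printed model: the argument and coupling brackets VANISH,
# the two runs' outputs differ by the NE5 bracket alone at ANY two couplings and ANY two backgrounds (Track A, node N18)

HONEST FRAMING.  Count-neutral kernel bookkeeping; NOT a node discharge.  Referee ref-B's READ #66 pin on
`BalabanUVNodesN18KingModel` (p411731) made kernel-explicit: King's `A = 0` minimiser kernels read NEITHER the coupling
sequence NOR the background, so in the node-U3 decomposition `T4OutputRate.u3_threeBrackets` ∕ `u3_geometric` (the K4 → N19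
edge: argument bracket `LipBackground` × NE3, coupling bracket `NE9` × coupling matching, functional bracket `NE5`) the
first two brackets hold with the ZERO constant families (`lipBackground_of_unread` here; `N18Coherence.ne9_zero_of_couplingBlind`)
and the U3 target `|E^A(g^A, U^A, X) − E^B(g^B, U^B, X)| ≤ E₀′θ^j e^{−κ d_j(X)}` holds with `E₀′ = 0 + 0 + C₅` at ANY two
admissible coupling sequences and ANY two backgrounds — in the model the «two runs at two couplings» content of node U3 is
carried ENTIRELY by NE5 (`u3Target_of_unread`, `u3Target_of_kingModel`).  King's scalar MODEL ([King1986], template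
literature), NOT Bałaban's covariant outputs (NE5∕NE9 there NOT IN PRINT; NODE O 0∕1); nothing continuum ∕ ℝ⁴ ∕ OS ∕
mass-gap ∕ Clay.  0 `sorry`, 0 `def`, standard axioms.

Sources: C. King, Commun. Math. Phys. **102** (1986) [King1986] Prop. 3.8 (3.71) p. 664, p. 665; T. Bałaban, Commun. Math.
Phys. **109** (1987) [Balaban1987RG1] §0 p. 256, §1 p. 263, §5 p. 298 (the printed words behind `LipBackground` ∕ `NE9`);
Commun. Math. Phys. **119** (1988) [Balaban1988Convergent] (2.27)–(2.28) p. 259.  Nothing here is a claim about the Yang–Mills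
mass gap.
-/

noncomputable section

namespace Summit.QuantumFields.YangMills.BalabanUVNodes.N18KingModel

open Real
open Literature.MathematicalPhysics.QuantumFieldTheory.Balaban1983to89.T4OutputRate
  (Carriers Functional NE5 NE9 LipBackground u3_geometric)
open Literature.MathematicalPhysics.QuantumFieldTheory.Balaban1983to89.B5Prop11Plancherel (Tor fine)
open Literature.MathematicalPhysics.QuantumFieldTheory.King1986 (aK prop38RateConst prop38PosConst)
open Literature.MathematicalPhysics.QuantumFieldTheory.King1986.Torus (minimiser)
open Summit.QuantumFields.YangMills.BalabanUVNodes.N18Coherence (ne9_zero_of_couplingBlind)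

/-! ## §1 A functional that does not read the background has the argument bracket with constant `0` -/

/-- A functional that does not read the background is `LipBackground` with the ZERO constant family, on any carriers,
window and decay rate (compare `N18Coherence.lipBackground_iff_of_gauge_zero`: on gauge-zero carriers this is the ONLY way
to be `LipBackground`). [cite: Balaban1988Convergent, (2.27)-(2.28) p.259] -/
theorem lipBackground_of_unread {C : Carriers} {EA : Functional C C.BgA} (h : ∀ g U U' X, EA g U X = EA g U' X)
    (W : Set (ℕ → ℝ)) (κ : ℝ) : LipBackground EA W κ (fun _ _ => 0) := by
  intro g _ U U' X
  rw [h g U U' X, sub_self, abs_zero, zero_mul, zero_mul]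

/-! ## §2 Node U3's target at any two couplings and backgrounds, from NE5 alone -/

/-- **NODE U3's TARGET SHAPE FROM THE NE5 BRACKET ALONE.**  If run A's functional reads neither the coupling sequence nor
the background and `NE5 EA EB W κ θ C₅` holds, then for all `gA, gB ∈ W`, all backgrounds `UA`, `UB` and every domain `X`:
`|EA gA UA X − EB gB UB X| ≤ (0 + 0 + C₅)·θ^{scale X}·e^{−κ d X}` — `T4OutputRate.u3_geometric` BY NAME with vanishing
argument and coupling brackets (`a = b = 0`, `CU ≡ 0`, `Λ ≡ 0`; the closeness `δ` is the actual gauge, unconstrained).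
[cite: Balaban1987RG1, §1 p.263 and §5 p.298] -/
theorem u3Target_of_unread {C : Carriers} {EA : Functional C C.BgA} {EB : Functional C C.BgB}
    (hU : ∀ g U U' X, EA g U X = EA g U' X) (hg : ∀ g g' U X, EA g U X = EA g' U X)
    {W : Set (ℕ → ℝ)} {κ θ C₅ : ℝ} (h5 : NE5 EA EB W κ θ C₅)
    {gA gB : ℕ → ℝ} (hgA : gA ∈ W) (hgB : gB ∈ W) (UA : C.BgA) (UB : C.BgB) (X : C.Dom) :
    |EA gA UA X - EB gB UB X| ≤ (0 + 0 + C₅) * θ ^ C.scale X * Real.exp (-(κ * C.d X)) :=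
  u3_geometric (ne9_zero_of_couplingBlind hg W κ) (lipBackground_of_unread hU W κ) h5 hgA hgB
    (δ := C.gauge UA (C.transport UB)) le_rfl X (le_refl (0 : ℝ)) (a := 0) (b := 0) (by rw [zero_mul, zero_mul])
    (by simp)

variable {d : ℕ}

/-- **… AT KING'S MODEL** (the reading hypotheses of `ne5_of_kingModel`, p411731): at ANY two coupling sequences of the
window and ANY two backgrounds the two runs' model outputs differ by `(0 + 0 + C₅(a, L, d, γ))·(L^{−γ})^{scale X}` — node U3's
composed target for the printed model, its content carried entirely by the NE5 bracket (King 1986 Prop. 3.8 (3.71) line 1,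
n18-b's `king_prop38_torus`). [cite: King1986, Prop. 3.8 (3.71) p.664, p.665] -/
theorem u3Target_of_kingModel (hd : 0 < d) {L : ℕ} [NeZero L] (hLodd : Odd L) (hL : 2 ≤ L) {n : ℕ} (hn : 1 ≤ n)
    (M : Fin d → ℕ) [∀ μ, NeZero (M μ)] {a m2 : ℝ} (ha : 0 < a) (hm : 0 < m2) {γ : ℝ} (hγ0 : 0 ≤ γ) (hγ1 : γ ≤ 1)
    (C : Carriers) (hscale : ∀ X, 1 ≤ C.scale X) (site : C.Dom → Tor M)
    (xA : (X : C.Dom) → Tor (fine (L ^ C.scale X) M)) (xB : (X : C.Dom) → Tor (fine (L ^ n * L ^ C.scale X) M))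
    (hx : ∀ X μ, (xA X μ).val = (xB X μ).val / L ^ n)
    (EA : Functional C C.BgA) (EB : Functional C C.BgB)
    (hEA : ∀ g U X, EA g U X =
      minimiser (L ^ C.scale X) M (aK a L (C.scale X)) (((L ^ C.scale X : ℕ) : ℝ) ^ 2) m2 (Pi.single (site X) 1) (xA X))
    (hEB : ∀ g U X, EB g U X =
      minimiser (L ^ n * L ^ C.scale X) M (aK a L (C.scale X + n)) (((L ^ n * L ^ C.scale X : ℕ) : ℝ) ^ 2) m2
        (Pi.single (site X) 1) (xB X))
    (W : Set (ℕ → ℝ)) {gA gB : ℕ → ℝ} (hgA : gA ∈ W) (hgB : gB ∈ W) (UA : C.BgA) (UB : C.BgB) (X : C.Dom) :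
    |EA gA UA X - EB gB UB X| ≤
      (0 + 0 + (prop38RateConst a a (a * (2 * ((a * (1 - ((L : ℝ) ^ 2)⁻¹))⁻¹ + π ^ 2 / 48 + 1 / 3))) ((π ^ 2 / 4) ^ d) d γ
        + prop38PosConst a ((π ^ 2 / 4) ^ d) d γ)) * ((L : ℝ) ^ (-γ)) ^ C.scale X * Real.exp (-(0 * C.d X)) :=
  u3Target_of_unread (fun g U U' X => by rw [hEA, hEA]) (fun g g' U X => by rw [hEA, hEA])
    (ne5_of_kingModel hd hLodd hL hn M ha hm hγ0 hγ1 C hscale site xA xB hx EA EB hEA hEB W) hgA hgB UA UB X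

end Summit.QuantumFields.YangMills.BalabanUVNodes.N18KingModel

end
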